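import Summits.HubbardSuperconductivity.HubbardSuperconductivity.Theses.ThermalWedge
import Summits.HubbardSuperconductivity.HubbardSuperconductivity.Theorems.TwTipContinuation.Negative.SeededChords

/-!
# Route `ThermalWedge` — glue item `TwCeilingGlue` (stmt-HubbardSuperconductivity-1705)

`TwSectorEnergyLowerBound → TwPureThermalBound → TwApproximatingHamiltonian → TwSourcedInertness →
TwExponentialCeiling`.

Pure bookkeeping over the reals plus ONE finite-dimensional fact, the CEILING CHORD
`order_le_rightChord` of `Theorems/TwTipContinuation/Negative/SeededChords.lean`: for a normalised
sector ground state `ψ` of the pure model (`g = 0`) and `0 < g₁`,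
`(g₁/L²)·re⟨ψ,P_Lψ⟩ ≤ E_L(0) − E_L(g₁)`.  Constants (planner's sketch): given `δ` take
`(μ₁,μ₂,U₀ᵖ)` from `TwPureThermalBound`, `(U₀ⁱ,a,C)` from `TwSourcedInertness` for `[μ₁,μ₂]`,
`U₀ := min U₀ᵖ U₀ⁱ`, `β := e^{a/U}`, `g₁ := 1/(C(1+log β)) = U/(C(a+U))` (so that inertness gives
`p̃_L(h) − h²/g₁ ≤ p̃_L(0) = p_L(0)`), `ε := e^{-a/U}`; output constant `C·(a+U₀ⁱ)·(log 4 + 2)`.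
Chain: `g₁⟨P_L⟩/L⁴ ≤ e(0) − e(g₁) ≤ [μn − p_L(0) + log4/β + ε] − [μn − p_L(g₁)]
≤ p̃_L(h_L) − h_L²/g₁ + ε − p_L(0) + log4/β + ε ≤ log4/β + 2ε = (log 4 + 2)e^{-a/U}`.
-/

namespace Summit.HubbardSuperconductivity.HubbardSuperconductivity.Theorems

open Literature.MathematicalPhysics.QuantumLattice Matrix
open Summit.HubbardSuperconductivity.HubbardSuperconductivity.Theses.ThermalWedge
open Summit.HubbardSuperconductivity.TwTipContinuation.Negative

/-- The real-arithmetic core of the ceiling chain: chord + sector lower bound + thermal bound +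
approximating Hamiltonian + inertness give `⟨P⟩/L⁴ ≤ (log4/β + 2ε)/g₁`. [folklore] -/
theorem twCeiling_bookkeeping {E₀ E₁ P pg p₀ ph n n' g₁ L β ε K lb h : ℝ} (hL : 0 < L)
    (hg₁ : 0 < g₁) (hchord : (g₁ - 0) / L ^ 2 * P ≤ E₀ - E₁) (hlow : n - pg ≤ E₁ / L ^ 2)
    (hup : E₀ / L ^ 2 + p₀ - n' ≤ lb / β + ε) (hn : n = n') (hh : pg ≤ ph - h ^ 2 / g₁ + ε)
    (hin : ph - p₀ ≤ K * h ^ 2) (hkey : h ^ 2 / g₁ = K * h ^ 2) :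
    P / L ^ 4 ≤ (lb / β + 2 * ε) / g₁ := by
  have hL2 : 0 < L ^ 2 := by positivity
  subst hn
  have hpg : pg ≤ p₀ + ε := by linarith
  have he : (E₀ - E₁) / L ^ 2 ≤ lb / β + 2 * ε := by
    rw [sub_div]
    linarith
  have hc : (g₁ - 0) / L ^ 2 * P / L ^ 2 ≤ (E₀ - E₁) / L ^ 2 :=
    div_le_div_of_nonneg_right hchord hL2.le
  have hre : (g₁ - 0) / L ^ 2 * P / L ^ 2 = g₁ * (P / L ^ 4) := by
    field_simp
    ring
  rw [le_div_iff₀ hg₁, mul_comm]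
  linarith

/-- **`TwCeilingGlue`** (stmt-HubbardSuperconductivity-1705): the exponential ceiling on the pure
model's every-ground-state `d`-wave order follows from the sector energy lower bound, the pure
thermal bound, the approximating-Hamiltonian theorem and sourced inertness, by the ceiling chord
`order_le_rightChord` and bookkeeping. -/
theorem twCeilingGlue_proof : TwCeilingGlue := by
  intro hSec hPure hAHM hInert δ hδ
  obtain ⟨μ₁, μ₂, hμ₁, hμ₁₂, hμ₂, U₀p, hU₀p, hP⟩ := hPure δ hδ
  obtain ⟨U₀i, a, C, hU₀i, ha, hC, hI⟩ := hInert μ₁ μ₂ hμ₁ hμ₁₂ hμ₂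
  have hlog4 : 0 < Real.log 4 := Real.log_pos (by norm_num)
  refine ⟨min U₀p U₀i, a, C * (a + U₀i) * (Real.log 4 + 2), lt_min hU₀p hU₀i, ha,
    by positivity, ?_⟩
  intro U hU
  obtain ⟨hU0, hUle⟩ := hU
  have hUp : U ≤ U₀p := hUle.trans (min_le_left _ _)
  have hUi : U ≤ U₀i := hUle.trans (min_le_right _ _)
  have haU : 0 < a / U := div_pos ha hU0
  set β : ℝ := Real.exp (a / U) with hβdef
  have hβ1 : 1 ≤ β := Real.one_le_exp haU.le
  have hβpos : 0 < β := Real.exp_pos _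
  have hlogβ : Real.log β = a / U := Real.log_exp _
  have h1log : 0 < 1 + Real.log β := by rw [hlogβ]; positivity
  obtain ⟨μ, hμ, hP'⟩ := hP U ⟨hU0, hUp⟩ β hβ1
  set ε : ℝ := Real.exp (-a / U) with hεdef
  have hε : 0 < ε := Real.exp_pos _
  have hεβ : ε = β⁻¹ := by rw [hεdef, hβdef, neg_div, Real.exp_neg]
  obtain ⟨L₁, hL₁⟩ := hP' ε hε
  obtain ⟨L₂, hL₂⟩ := hI U hU0 hUi β hβ1 le_rfl μ hμ
  set g₁ : ℝ := 1 / (C * (1 + Real.log β)) with hg₁def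
  have hg₁ : 0 < g₁ := div_pos one_pos (mul_pos hC h1log)
  obtain ⟨-, hHard⟩ := hAHM U μ β g₁ hβpos hg₁
  obtain ⟨L₃, hL₃⟩ := hHard ε hε
  refine ⟨max L₁ (max L₂ L₃), ?_⟩
  intro L _ hL ψ hψ hgs
  have hLmax : max L₂ L₃ ≤ L := (le_max_right _ _).trans hL
  have hL1 : L₁ ≤ L := (le_max_left _ _).trans hL
  have hL2 : L₂ ≤ L := (le_max_left _ _).trans hLmax
  have hL3 : L₃ ≤ L := (le_max_right _ _).trans hLmax
  have hLpos : (0 : ℝ) < (L : ℝ) := by exact_mod_cast NeZero.pos L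
  -- the ceiling chord at `g = 0 < g₁`
  have hgs' : IsGroundStateInSector (hubbardTorus 2 L 1 U - ((0 / (L : ℝ) ^ 2 : ℝ) : ℂ) •
      ((pairField dWaveFormFactor L)ᴴ * pairField dWaveFormFactor L))
      (2 * ⌊(1 - δ) * (L : ℝ) ^ 2 / 2⌋₊) 0 ψ := by
    rw [seededH_zero]; exact hgs
  have hchord := order_le_rightChord (U := U) (g := 0) (g'' := g₁) hg₁ hψ hgs'
  rw [seededH_zero] at hchord
  -- the sector is inhabited by `ψ`
  have hV : szSector (Λ := FermionTorus 2 L) (2 * ⌊(1 - δ) * (L : ℝ) ^ 2 / 2⌋₊) 0 ≠ ⊥ :=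
    (Submodule.ne_bot_iff _).2 ⟨ψ, hgs.1, hgs.2.1⟩
  have hlow := hSec L (2 * ⌊(1 - δ) * (L : ℝ) ^ 2 / 2⌋₊) U μ β g₁ hβpos hV
  have hup := hL₁ L hL1
  have hn : μ * ((2 * ⌊(1 - δ) * (L : ℝ) ^ 2 / 2⌋₊ : ℕ) : ℝ) / (L : ℝ) ^ 2 =
      μ * ((2 * ⌊(1 - δ) * (L : ℝ) ^ 2 / 2⌋₊) : ℝ) / (L : ℝ) ^ 2 := by
    push_cast; ring
  obtain ⟨h, hh⟩ := hL₃ L hL3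
  have hin := hL₂ L hL2 h
  rw [dWaveSourceTorus_zero] at hin
  have hkey : h ^ 2 / g₁ = C * (1 + Real.log β) * h ^ 2 := by
    rw [hg₁def, div_div_eq_mul_div, div_one]
    ring
  have hmain := twCeiling_bookkeeping hLpos hg₁ hchord hlow hup hn hh hin hkey
  -- constants
  have hg₁inv : (Real.log 4 / β + 2 * ε) / g₁ = ε * (Real.log 4 + 2) * C * (1 + a / U) := by
    rw [hg₁def, div_div_eq_mul_div, div_one, hlogβ, hεβ]
    ring
  have h1aU : 1 + a / U ≤ (a + U₀i) / U := by
    rw [show (1 : ℝ) + a / U = (U + a) / U by rw [add_div, div_self hU0.ne']]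
    exact div_le_div_of_nonneg_right (by linarith) hU0.le
  have hεC : 0 ≤ ε * (Real.log 4 + 2) * C := by positivity
  calc _ ≤ (Real.log 4 / β + 2 * ε) / g₁ := hmain
    _ = ε * (Real.log 4 + 2) * C * (1 + a / U) := hg₁inv
    _ ≤ ε * (Real.log 4 + 2) * C * ((a + U₀i) / U) := mul_le_mul_of_nonneg_left h1aU hεC
    _ = C * (a + U₀i) * (Real.log 4 + 2) * ε / U := by ring

end Summit.HubbardSuperconductivity.HubbardSuperconductivity.Theorems
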